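import Literature.AnabelianGeometry.EtaleTheta.GalSectThm110iiiEndKnit
import HarnessLib

/-!
# [EtTh] Thm. 1.10 (iii): the `(μ)` input («`±1 ↦ ±1`») REDUCED to the torsion of `(K^×)^∧`

The end knit `thm110iiiGalSect_of_genuineTorsor` (abc-iut-w5-d062, p435878) takes the named input
(μ): for THE class transport `e` along `Γ ∘ Inn(c)` and any homomorphism `δ : (K̇α^×)^∧ → (K̇β^×)^∧` making `e`
equivariant, `δ(μ₂) = μ₂`.  This file proves the torsor bookkeeping behind it:

* `GalSect.CuspPair.TorsorData.injective_of_equivariant` / `surjective_of_equivariant` /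
  `bijective_of_equivariant` — a homomorphism intertwining two FREE TRANSITIVE actions along an injective /
  surjective / bijective map of the underlying sets is injective / surjective / bijective;
* `MuTwoSetting.muTwoHat_le_twoTorsion` — `μ₂(K)` consists of elements of order dividing `2` in `(K^×)^∧`;
* `MuTwoSetting.muTwoHat_map_eq_of_bijective` — a BIJECTIVE homomorphism carries `μ₂` onto `μ₂` as soon as
  the `2`-torsion of each `(K^×)^∧` is `μ₂(K)` (the classical structure fact `(K^×)^∧_tors = μ(K)` for a
  `p`-adic field, here the named input (μtor));
* `MuTwoSetting.DotCCusp.hμ_of_twoTorsion` — hence (μ) in the EXACT binder shape of the end knit, from (b1)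
  and (μtor) at `α` and `β`: the class transport is bijective (`classTransport_bijective`, p433009), so the
  intertwining `δ` is bijective;
* `thm110iiiGalSect_of_genuineTorsor_twoTorsion` — the end knit with (μ) replaced by (μtor).

HONEST FRAMING: (μtor) is a classical fact about local fields, NOT proved here (it needs the structure of the
profinite completion of `K^×`); nothing printed is asserted; typed ≠ proved; no side taken on [IUTchIII]
Cor. 3.12, on which nothing here bears.
-/

namespace Literature.AnabelianGeometry.EtaleTheta

open scoped Pointwise
open Literature.AnabelianGeometry.SemiGraphs

namespace GalSect.CuspPair.TorsorData

variable {G G' : Type*} [Group G] [TopologicalSpace G] [Group G'] [TopologicalSpace G']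
  {P : CuspPair G} {P' : CuspPair G'} {A B : Type*} [Group A] [Group B]
  (T : P.TorsorData A) (T' : P'.TorsorData B)

/-- Freeness: two group elements moving one class to the same class are equal.
[cite: MochizukiGalSect2005, Def 4.1 (ii) p.34] -/
theorem eq_of_act_eq {a b : A} {c : P.SplittingClass} (h : T.act a c = T.act b c) : a = b :=
  (T.existsUnique_act_eq c (T.act b c)).unique h rfl

/-- A homomorphism `δ` intertwining two free transitive actions along an INJECTIVE map `e` is injective
(given one class to act on). [cite: MochizukiGalSect2005, Def 4.1 (ii) p.34] -/
theorem injective_of_equivariant (c₀ : P.SplittingClass) {e : P.SplittingClass → P'.SplittingClass}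
    (he : Function.Injective e) (δ : A →* B) (hequiv : ∀ k cl, e (T.act k cl) = T'.act (δ k) (e cl)) :
    Function.Injective δ := by
  intro a b hab
  apply T.eq_of_act_eq (c := c₀)
  apply he
  rw [hequiv, hequiv, hab]

/-- A homomorphism `δ` intertwining two free transitive actions along a SURJECTIVE map `e` is surjective
(given one class to act on). [cite: MochizukiGalSect2005, Def 4.1 (ii) p.34] -/
theorem surjective_of_equivariant (c₀ : P.SplittingClass) {e : P.SplittingClass → P'.SplittingClass}
    (he : Function.Surjective e) (δ : A →* B) (hequiv : ∀ k cl, e (T.act k cl) = T'.act (δ k) (e cl)) :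
    Function.Surjective δ := by
  intro b
  obtain ⟨cl, hcl⟩ := he (T'.act b (e c₀))
  obtain ⟨k, hk, -⟩ := T.existsUnique_act_eq c₀ cl
  refine ⟨k, T'.eq_of_act_eq (c := e c₀) ?_⟩
  rw [← hequiv, hk, hcl]

/-- A homomorphism intertwining two free transitive actions along a BIJECTION is bijective.
[cite: MochizukiGalSect2005, Def 4.1 (ii) p.34] -/
theorem bijective_of_equivariant (c₀ : P.SplittingClass) {e : P.SplittingClass → P'.SplittingClass}
    (he : Function.Bijective e) (δ : A →* B) (hequiv : ∀ k cl, e (T.act k cl) = T'.act (δ k) (e cl)) :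
    Function.Bijective δ :=
  ⟨T.injective_of_equivariant T' c₀ he.1 δ hequiv, T.surjective_of_equivariant T' c₀ he.2 δ hequiv⟩

end GalSect.CuspPair.TorsorData

namespace MuTwoSetting

variable {p : ℕ} [Fact p.Prime]

/-- `μ₂(K) ⊆ (K^×)^∧[2]`: every element of `μ₂(K)` (the image of the square roots of unity of `K`) squares to
`1` in `(K^×)^∧`. [cite: MochizukiEtTh2009, Thm 1.10 (iii) p.30] -/
theorem muTwoHat_le_twoTorsion (M : MuTwoSetting p)
    {x : GalSect.KxHat M.toThetaSetting.toTemperedCurve} (hx : x ∈ M.muTwoHat) : x * x = 1 := by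
  obtain ⟨u, hu, rfl⟩ := hx
  rw [← map_mul, ← pow_two, show u ^ 2 = 1 from hu, map_one]

/-- **`δ(μ₂) = μ₂` for a BIJECTIVE homomorphism**, granted (μtor) «the `2`-torsion of `(K^×)^∧` is `μ₂(K)`» on
both sides. [cite: MochizukiEtTh2009, Thm 1.10 (iii) p.30] -/
theorem muTwoHat_map_eq_of_bijective (Mα Mβ : MuTwoSetting p)
    (δ : GalSect.KxHat Mα.toThetaSetting.toTemperedCurve →* GalSect.KxHat Mβ.toThetaSetting.toTemperedCurve)
    (hδ : Function.Bijective δ)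
    (htorα : ∀ x : GalSect.KxHat Mα.toThetaSetting.toTemperedCurve, x * x = 1 → x ∈ Mα.muTwoHat)
    (htorβ : ∀ x : GalSect.KxHat Mβ.toThetaSetting.toTemperedCurve, x * x = 1 → x ∈ Mβ.muTwoHat) :
    Mα.muTwoHat.map δ = Mβ.muTwoHat := by
  ext y
  constructor
  · rintro ⟨x, hx, rfl⟩
    apply htorβ
    rw [← map_mul, Mα.muTwoHat_le_twoTorsion hx, map_one]
  · intro hy
    obtain ⟨x, rfl⟩ := hδ.2 y
    refine ⟨x, htorα x (hδ.1 ?_), rfl⟩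
    rw [map_mul, Mβ.muTwoHat_le_twoTorsion hy, map_one]

namespace DotCCusp

variable {Mα Mβ : MuTwoSetting p} {εα : Mα.GtpC} {εβ : Mβ.GtpC}

/-- **(μ) from (b1) + (μtor).**  For cusp data `Ċα`, `Ċβ` whose cusp pairs correspond under `Φ` (b1), THE class
transport `e` along `Φ` is a bijection (p433009), so any homomorphism `δ` of structure groups making `e`
equivariant is bijective (free transitive actions), hence carries `μ₂` onto `μ₂` by (μtor) — this is the (μ)
input of `thm110iiiGalSect_of_genuineTorsor` in its exact binder shape (`Φ = Γ ∘ Inn(c)`).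
[cite: MochizukiEtTh2009, Thm 1.10 (iii) p.30] -/
theorem hμ_of_twoTorsion (Cα : Mα.DotCCusp εα) (Cβ : Mβ.DotCCusp εβ) (Φ : Mα.GtpC ≃ₜ* Mβ.GtpC)
    (hpair : Cα.pair.map Φ = Cβ.pair) {S₀ : Subgroup Mα.GtpC} (hS₀ : S₀ ∈ Cα.pair.splittings)
    (htorα : ∀ x : GalSect.KxHat Mα.toThetaSetting.toTemperedCurve, x * x = 1 → x ∈ Mα.muTwoHat)
    (htorβ : ∀ x : GalSect.KxHat Mβ.toThetaSetting.toTemperedCurve, x * x = 1 → x ∈ Mβ.muTwoHat)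
    (δ : GalSect.KxHat Mα.toThetaSetting.toTemperedCurve →* GalSect.KxHat Mβ.toThetaSetting.toTemperedCurve)
    (e : Cα.pair.SplittingClass → Cβ.pair.SplittingClass)
    (he : ∀ (S : Subgroup Mα.GtpC) (hS : S ∈ Cα.pair.splittings),
      ∃ h', e (GalSect.CuspPair.SplittingClass.mk Cα.pair S hS) =
        GalSect.CuspPair.SplittingClass.mk Cβ.pair (S.map Φ.toMulEquiv.toMonoidHom) h')
    (hequiv : ∀ (k : GalSect.KxHat Mα.toThetaSetting.toTemperedCurve) (cl : Cα.pair.SplittingClass),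
      e (Cα.torsor.act k cl) = Cβ.torsor.act (δ k) (e cl)) :
    Mα.muTwoHat.map δ = Mβ.muTwoHat :=
  muTwoHat_map_eq_of_bijective Mα Mβ δ
    (Cα.torsor.bijective_of_equivariant Cβ.torsor (GalSect.CuspPair.SplittingClass.mk Cα.pair S₀ hS₀)
      (GalSect.CuspPair.classTransport_bijective hpair he) δ hequiv)
    htorα htorβ

end DotCCusp

end MuTwoSetting

section EndKnit

variable {p : ℕ} [Fact p.Prime] {Mα Mβ : MuTwoSetting p} {εα : Mα.GtpC} {εβ : Mβ.GtpC}
  {hCα : Mα.toThetaSetting.Compat} {hCβ : Mβ.toThetaSetting.Compat}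
  {Eα : Mα.toThetaSetting.EtaleThetaData} {Eβ : Mβ.toThetaSetting.EtaleThetaData}
  {γ : Mα.dotC εα ≃ₜ* Mβ.dotC εβ}

/-- **[EtTh] Thm. 1.10 (iii) AT THE GENUINE `H¹`-TORSOR with (μ) replaced by (μtor)** — the end knit p435878
with its «`±1 ↦ ±1`» input discharged down to the classical fact «`(K^×)^∧[2] = μ₂(K)`» at `α` and at `β`
(`DotCCusp.hμ_of_twoTorsion`); residual = law, topological side conditions, (b1), (gen) ×2, (μtor) ×2, (b3).
[cite: MochizukiEtTh2009, Thm 1.10 (iii) p.30] -/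
theorem thm110iiiGalSect_of_genuineTorsor_twoTorsion [T1Space Mα.GtpC] [T1Space Mβ.GtpC]
    (H : Thm110Hypothesis εα εβ hCα hCβ Eα Eβ γ)
    (Sα : Mα.StandardData Eα.toKummerData) (Sβ : Mβ.StandardData Eβ.toKummerData)
    (Cα : Mα.DotCCusp εα) (Cβ : Mβ.DotCCusp εβ)
    [IsMulCommutative Cα.pair.I] [IsMulCommutative Cβ.pair.I]
    (hDα : IsClosed (Cα.pair.D : Set Mα.GtpC)) (hIα : IsCompact (Cα.pair.I : Set Mα.GtpC))
    (hDβ : IsClosed (Cβ.pair.D : Set Mβ.GtpC)) (hIβ : IsCompact (Cβ.pair.I : Set Mβ.GtpC))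
    -- (law) [GalSect] Def. 4.1 (iii)
    (hcan : Cα.torsor.IsStructure (GalSect.unitsHat Mα.toThetaSetting.toTemperedCurve) Cα.canonical)
    -- (b1) cusp-pair transport
    {c : Mβ.GtpC} (hc : c ∈ Mβ.dotC εβ)
    (hpair : Cα.pair.map (H.Γ.trans (Mβ.innerAutC c)) = Cβ.pair)
    -- (gen) the cusp torsors ARE the genuine `H¹`-torsors
    {S₀α : Subgroup Mα.GtpC} (hS₀α : S₀α ∈ Cα.pair.splittings)
    {S₀β : Subgroup Mβ.GtpC} (hS₀β : S₀β ∈ Cβ.pair.splittings)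
    (hgenα : haveI := Cα.pair.ID_normal
      ∃ κ : GalSect.KxHat Mα.toThetaSetting.toTemperedCurve ≃*
          ↥(ContH1.resKer Cα.pair.ID (⊤ : Subgroup Cα.pair.D)
            (Cα.pair.isClosedComplement_of_mem_splittings hS₀α).le_left),
        ∀ k cl, Cα.torsor.act k cl = (Cα.pair.torsorDataH1 hDα hIα hS₀α).act (κ k) cl)
    (hgenβ : haveI := Cβ.pair.ID_normal
      ∃ κ : GalSect.KxHat Mβ.toThetaSetting.toTemperedCurve ≃*
          ↥(ContH1.resKer Cβ.pair.ID (⊤ : Subgroup Cβ.pair.D)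
            (Cβ.pair.isClosedComplement_of_mem_splittings hS₀β).le_left),
        ∀ k cl, Cβ.torsor.act k cl = (Cβ.pair.torsorDataH1 hDβ hIβ hS₀β).act (κ k) cl)
    -- (μtor) the `2`-torsion of `(K^×)^∧` is `μ₂(K)`, at `α` and at `β`
    (htorα : ∀ x : GalSect.KxHat Mα.toThetaSetting.toTemperedCurve, x * x = 1 → x ∈ Mα.muTwoHat)
    (htorβ : ∀ x : GalSect.KxHat Mβ.toThetaSetting.toTemperedCurve, x * x = 1 → x ∈ Mβ.muTwoHat)
    -- (b3) canonical integral structures correspond under THE class transport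
    (hecan : ∀ (e : Cα.pair.SplittingClass → Cβ.pair.SplittingClass),
      (∀ (S : Subgroup Mα.GtpC) (hS : S ∈ Cα.pair.splittings),
        ∃ h', e (GalSect.CuspPair.SplittingClass.mk Cα.pair S hS) =
          GalSect.CuspPair.SplittingClass.mk Cβ.pair
            (S.map (H.Γ.trans (Mβ.innerAutC c)).toMulEquiv.toMonoidHom) h') →
      e '' Cα.canonical ⊆ Cβ.canonical) :
    Thm110iiiGalSect H Sα Sβ Cα Cβ :=
  thm110iiiGalSect_of_genuineTorsor H Sα Sβ Cα Cβ hDα hIα hDβ hIβ hcan hc hpair hS₀α hS₀β hgenα hgenβ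
    (Cα.hμ_of_twoTorsion Cβ _ hpair hS₀α htorα htorβ) hecan

end EndKnit

end Literature.AnabelianGeometry.EtaleTheta
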